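import Summits.ResolutionOfSingularities.ResolutionOfSingularities.Theorems.MarkedTransferCampaignW46ThreefoldsGammaFreeGlobalIntersection
import HarnessLib

/-!
# [OURS · L1 W4.6 rung (ii) ladder support] STRICT TRANSFORMS OF BRANCHES UNDER THE POINT BLOW-UP OF A REGULAR SURFACE, I:
# charts of a quadratic transform, the exceptional curve is regular, and THE POINT OF A REGULAR BRANCH (brick for the
# `d = 2` rung (ii-2), design point (3) of the holder's RUNG-II-2-PLAN, wish-list items (I4), (I5))

Cell res-hironaka, LADDER-RESOLUTION rung L (D-0089), slot W4.6, rung (ii); seat res-L1-s46-pv-10 = res-D-pv-047, filed as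
SUPPORT for the `d = 2` rung (holder res-L1-s46-pv-11 = res-D-pv-049, GO 2026-08-27T05:30:58Z). Host route MarkedTransfer,
host item `HypersurfaceOrderReductionDimLeThree` (stmt-ResolutionOfSingularities-16156), `--kind proof --supports … --as helper`.
Sequel of `…GammaFreeGlobalIntersection.lean` (p504615: the numbers `i(f, g) = λ_R(R/(f, g))`). Vocabulary = the tree's
quadratic transforms inside the function field (`Resolution/QuadraticTransforms*`: `IsQuadraticTransform R R₁`,
`blowupRing R x = R[𝔪/x]`, `chartAdjoin x y = R[y/x]`, `extIdeal`), i.e. the local rings of the blown-up surface at the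
points over the centre, as delivered by the scheme ↔ RLR dictionary of res-L1-s46-pv-9 (D3). The closed points of the
exceptional curve `E` are the TWO-DIMENSIONAL quadratic transforms `R₁` (`ringKrullDim R₁ = 2`); a CHART ELEMENT of `R₁` is
an `x ∈ 𝔪 ∖ 0` with `R[𝔪/x] ⊆ R₁` (the definition of `IsQuadraticTransform` provides one); then `𝔪 R₁ = x R₁` is the local
equation of `E` at `R₁`, and for a branch `f ∈ 𝔪` the element `f/x ∈ R₁` is a local equation of the strict transform of
a REGULAR branch (`f ∉ 𝔪²`). Everything is classical (Zariski; Huneke–Swanson §14; Hartshorne V §3); nothing is a statement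
of the manuscript under adjudication; no typed `Hironaka2017` candidate and no unproved named fact enters. DEF-FREE.
AI-written; weaker than expert review.

## What is proved (`R ⊆ K` a local ring; from `isRegularLocalRing_of_isQuadraticTransform` on: `R` regular,
## `ringKrullDim R = 2`, `Frac R = K`)

* Charts: `map_maximalIdeal_eq_span_of_blowupRing_le` / `extIdeal_maximalIdeal_eq_span_of_blowupRing_le` (**`𝔪 R₁ = x R₁`**
  in the chart `R[𝔪/x] ⊆ R₁`), `blowupRing_le_of_map_maximalIdeal_le` (converse), `exists_eq_div_of_blowupRing_le`
  (elements of a quadratic transform are chart fractions with unit denominators), `maximalIdeal_eq_map_comap_chart`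
  (`𝔪_{R₁}` is extended from any chart ring), `isNoetherianRing_of_isQuadraticTransform`,
  `exists_maximalIdeal_eq_span_pair_of_chart` (`𝔪_{R₁} = (x, φ)`).
* **(I5, local) the exceptional curve is regular at each closed point**: `isRegularLocalRing_of_isQuadraticTransform`
  (a two-dimensional quadratic transform is regular), `chart_not_mem_sq_maximalIdeal` (**`x ∉ 𝔪_{R₁}²`**).
* **(I4) the point of a regular branch**: `div_mem_maximalIdeal_iff_not_mem` (`f/x ∈ 𝔪_{R₁} ↔ x/f ∉ R₁`, instance-free
  reading of "the strict transform of `f` passes through `R₁`"), `blowupRing_le_of_div_mem_maximalIdeal`,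
  `comap_maximalIdeal_eq_span_pair`, and **`maximalIdeal_eq_span_pair_of_div_mem_maximalIdeal`: for `𝔪 = (x, f)`, at a
  quadratic transform where `f/x` is a non-unit, `𝔪_{R₁} = (x, f/x)`** — the strict transform meets `E` transversally there
  and is regular there. Uniqueness and existence of that point, the separation of transversal branches and the Noether
  drop `i₁ + 1 = i` are in part III `…GammaFreeGlobalIntersectionNoether.lean`.

References: C. Huneke, I. Swanson, *Integral Closure of Ideals, Rings, and Modules* (2006), §14.2 (p. 264), Thm. 14.5.2
[HunekeSwanson2006]; R. Hartshorne, *Algebraic Geometry* (1977), Ch. V Prop. 3.1, Prop. 3.6, Cor. 3.7 [Hartshorne1977];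
O. Zariski, P. Samuel, *Commutative Algebra* II (1960), App. 5 [ZariskiSamuel1960]; tree `Resolution/QuadraticTransforms{,Chart,
Structure,Factorization,KeyLemma}`, `Resolution/QuadraticTransformWeakTransform`. H. Hironaka, ms. 2017-03-23 — scope only,
under adjudication, not cited as fact. [Hironaka2017]
-/

noncomputable section

set_option linter.dupNamespace false

open IsLocalRing Polynomial

namespace Summit.ResolutionOfSingularities.ResolutionOfSingularities.Theorems

namespace CampaignW46

open Literature.AlgebraicGeometry.Resolution

universe u

variable {K : Type u} [Field K] {R R₁ : Subring K}

/-! ## A quadratic transform seen in a chart `R[𝔪/x] ⊆ R₁` -/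

section Chart

/-- In the chart `R[𝔪/x] ⊆ R₁` (`x ∈ 𝔪 ∖ 0`): **`𝔪 R₁ = x R₁`** — every `m ∈ 𝔪` is `x · (m/x)` with
`m/x ∈ R[𝔪/x]`. [cite: HunekeSwanson2006, §14.2 (p. 264)] -/
theorem map_maximalIdeal_eq_span_of_blowupRing_le [IsLocalRing R] {x : R}
    (hx : x ∈ maximalIdeal R) (hx0 : x ≠ 0) (hA : blowupRing R (x : K) ≤ R₁) :
    (maximalIdeal R).map (Subring.inclusion ((le_blowupRing R (x : K)).trans hA)) =
      Ideal.span {Subring.inclusion ((le_blowupRing R (x : K)).trans hA) x} := by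
  have hx0K : ((x : R) : K) ≠ 0 := fun e => hx0 (Subtype.ext e)
  apply le_antisymm
  · rw [Ideal.map_le_iff_le_comap]
    intro m hm
    rw [Ideal.mem_comap, Ideal.mem_span_singleton']
    refine ⟨⟨((m : R) : K) / x, hA (div_mem_blowupRing _ hm)⟩, Subtype.ext ?_⟩
    change ((m : R) : K) / x * (x : K) = (m : K)
    field_simp
  · rw [Ideal.span_singleton_le_iff_mem]
    exact Ideal.mem_map_of_mem _ hx

/-- The same in the `extIdeal` form of `QuadraticTransformWeakTransform` / of the marked quadratic tree
(`ctrlTransform`, `…ExitTree.lean`): `extIdeal 𝔪 R₁ = x R₁`. [cite: HunekeSwanson2006, §14.2 (p. 264)] -/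
theorem extIdeal_maximalIdeal_eq_span_of_blowupRing_le [IsLocalRing R] {x : R}
    (hx : x ∈ maximalIdeal R) (hx0 : x ≠ 0) (hA : blowupRing R (x : K) ≤ R₁) :
    extIdeal (maximalIdeal R) R₁ =
      Ideal.span {Subring.inclusion ((le_blowupRing R (x : K)).trans hA) x} := by
  rw [extIdeal_eq_map _ ((le_blowupRing R (x : K)).trans hA)]
  exact map_maximalIdeal_eq_span_of_blowupRing_le hx hx0 hA

/-- Conversely, **if `𝔪 R₁ ⊆ x R₁` then `R₁` lies in the chart `R[𝔪/x]`**. [folklore] -/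
theorem blowupRing_le_of_map_maximalIdeal_le [IsLocalRing R] (hle : R ≤ R₁) {x : R}
    (h : (maximalIdeal R).map (Subring.inclusion hle) ≤ Ideal.span {Subring.inclusion hle x}) :
    blowupRing R (x : K) ≤ R₁ := by
  refine Subring.closure_le.mpr ?_
  rintro z (hz | ⟨y, hy, rfl⟩)
  · exact hle hz
  · change ((y : R) : K) / x ∈ R₁
    by_cases hx0 : ((x : R) : K) = 0
    · rw [hx0, div_zero]; exact R₁.zero_mem
    obtain ⟨c, hc⟩ := Ideal.mem_span_singleton'.mp (h (Ideal.mem_map_of_mem _ hy))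
    have e : ((y : R) : K) / x = (c : K) := by
      have := congrArg (fun t : R₁ => (t : K)) hc
      simp only [Subring.coe_mul, Subring.coe_inclusion] at this
      rw [← this]; field_simp
    rw [e]; exact c.2

/-- **Elements of a quadratic transform are chart fractions with unit denominators**: in the chart
`R[𝔪/x] ⊆ R₁`, every `z ∈ R₁` is `a/s` with `a, s ∈ R[𝔪/x]`, `s ≠ 0` and `s⁻¹ ∈ R₁`
(`R₁ = R[𝔪/x]_{𝔪_{R₁} ∩ R[𝔪/x]}`, the tree's chart change `IsQuadraticTransform.eq_ofPrime`).
[cite: HunekeSwanson2006, §14.2 (p. 264)] -/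
theorem exists_eq_div_of_blowupRing_le [IsLocalRing R] [IsLocalRing R₁]
    (h₁ : IsQuadraticTransform R R₁) {x : R} (hx : x ∈ maximalIdeal R) (hx0 : x ≠ 0)
    (hA : blowupRing R (x : K) ≤ R₁) {z : K} (hz : z ∈ R₁) :
    ∃ a ∈ blowupRing R (x : K), ∃ s ∈ blowupRing R (x : K), s ≠ 0 ∧ s⁻¹ ∈ R₁ ∧ z = a / s := by
  have e := h₁.eq_ofPrime hx hx0 hA
  have hz' : z ∈ (LocalSubring.ofPrime (blowupRing R (x : K))
      ((maximalIdeal R₁).comap (Subring.inclusion hA))).toSubring := by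
    rw [← e]; exact hz
  obtain ⟨a, s, hs, rfl⟩ := mem_ofPrime_iff.mp hz'
  exact ⟨a, a.2, s, s.2, coe_ne_zero_of_not_mem hs, inv_mem_of_not_mem_comap hA hs, rfl⟩

/-- **The maximal ideal of a quadratic transform is extended from any chart ring**:
`𝔪_{R₁} = (𝔪_{R₁} ∩ A) R₁` for `R[𝔪/x] ⊆ A ⊆ R₁`. [folklore] -/
theorem maximalIdeal_eq_map_comap_chart [IsLocalRing R] [IsLocalRing R₁]
    (h₁ : IsQuadraticTransform R R₁) {x : R} (hx : x ∈ maximalIdeal R) (hx0 : x ≠ 0)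
    {A : Subring K} (hxA : blowupRing R (x : K) ≤ A) (hA : A ≤ R₁) :
    maximalIdeal R₁ =
      ((maximalIdeal R₁).comap (Subring.inclusion hA)).map (Subring.inclusion hA) := by
  refine le_antisymm ?_ Ideal.map_comap_le
  intro z hz
  obtain ⟨a, ha, s, hs, hs0, hsi, hzas⟩ :=
    exists_eq_div_of_blowupRing_le h₁ hx hx0 (hxA.trans hA) z.2
  have haA : a ∈ A := hxA ha
  have hzeq : z = Subring.inclusion hA ⟨a, haA⟩ * ⟨s⁻¹, hsi⟩ := Subtype.ext (by
    change (z : K) = a * s⁻¹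
    rw [hzas, div_eq_mul_inv])
  have haQ : (⟨a, haA⟩ : A) ∈ (maximalIdeal R₁).comap (Subring.inclusion hA) := by
    rw [Ideal.mem_comap]
    have e : Subring.inclusion hA ⟨a, haA⟩ = z * ⟨s, hA (hxA hs)⟩ := Subtype.ext (by
      change (a : K) = (z : K) * s
      rw [hzas, div_mul_cancel₀ _ hs0])
    rw [e]
    exact Ideal.mul_mem_right _ _ hz
  rw [hzeq]
  exact Ideal.mul_mem_right _ _ (Ideal.mem_map_of_mem _ haQ)

/-- A quadratic transform of a Noetherian local ring of `K` with two-generated maximal ideal is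
Noetherian (a localisation of the finitely generated chart ring `R[y/x]`). [folklore] -/
theorem isNoetherianRing_of_isQuadraticTransform [IsLocalRing R] [IsNoetherianRing R]
    [IsLocalRing R₁] (h₁ : IsQuadraticTransform R R₁) {x y : R}
    (hm : maximalIdeal R = Ideal.span {x, y}) (hx0 : x ≠ 0) (hA : blowupRing R (x : K) ≤ R₁) :
    IsNoetherianRing R₁ := by
  have hx : x ∈ maximalIdeal R := hm ▸ Ideal.subset_span (by simp)
  have hAeq : blowupRing R (x : K) = chartAdjoin x y := blowupRing_eq_adjoin hm
  have hA' : chartAdjoin (K := K) x y ≤ R₁ := hAeq ▸ hA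
  have e := h₁.eq_ofPrime_of_le hx hx0 hAeq.le hA'
  haveI : IsNoetherianRing (chartAdjoin (K := K) x y) := isNoetherianRing_adjoin_toSubring R _
  rw [e]
  exact isNoetherianRing_ofPrime

/-- **The maximal ideal of a quadratic transform in the chart `R[y/x]`, `𝔪 = (x, y)`, is `(x, φ)`**
for some `φ` (Huneke–Swanson p. 264: the primes of `R[y/x]` over `𝔪` are `(x, f)`; then extend to
`R₁`). [cite: HunekeSwanson2006, §14.2 (p. 264)] -/
theorem exists_maximalIdeal_eq_span_pair_of_chart [IsLocalRing R] [IsLocalRing R₁]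
    (h₁ : IsQuadraticTransform R R₁) {x y : R} (hm : maximalIdeal R = Ideal.span {x, y})
    (hx0 : x ≠ 0) (hA : blowupRing R (x : K) ≤ R₁) :
    ∃ φ : R₁, maximalIdeal R₁ = Ideal.span {Subring.inclusion h₁.dominates.1 x, φ} := by
  have hx : x ∈ maximalIdeal R := hm ▸ Ideal.subset_span (by simp)
  have hAeq : blowupRing R (x : K) = chartAdjoin x y := blowupRing_eq_adjoin hm
  have hA' : chartAdjoin (K := K) x y ≤ R₁ := hAeq ▸ hA
  set Q : Ideal (chartAdjoin (K := K) x y) := (maximalIdeal R₁).comap (Subring.inclusion hA')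
    with hQ
  have hmQ : (maximalIdeal R).map (chartIncl (K := K) x y) ≤ Q := by
    rw [Ideal.map_le_iff_le_comap]
    intro r hr
    rw [Ideal.mem_comap, hQ, Ideal.mem_comap]
    exact (incl_mem_maximalIdeal_iff h₁.dominates r).mpr hr
  obtain ⟨φ, hφ⟩ := exists_eq_span_pair_of_map_maximalIdeal_le hm hx0 rfl hmQ
  refine ⟨Subring.inclusion hA' φ, ?_⟩
  rw [maximalIdeal_eq_map_comap_chart h₁ hx hx0 hAeq.le hA', ← hQ, hφ, Ideal.map_span,
    Set.image_insert_eq, Set.image_singleton]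
  rfl

end Chart

/-! ## Two-dimensional quadratic transforms of a two-dimensional regular local ring: the exceptional
curve is regular at each of its closed points -/

section DimTwo

variable [IsRegularLocalRing R]

/-- A two-dimensional quadratic transform of a two-dimensional regular local ring `R` of `K` is a
regular local ring (the valuation alternative of the tree's dichotomy
`IsQuadraticTransform.mem_or_inv_mem_or_isRegularLocalRing` has dimension `≤ 1`).
[cite: HunekeSwanson2006, Thm. 14.5.2 (proof)] -/
theorem isRegularLocalRing_of_isQuadraticTransform [IsLocalRing R₁]
    (h₁ : IsQuadraticTransform R R₁) (hdim : ringKrullDim R = 2) (hRK : IsLocalRingOf R)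
    (hd₁ : ringKrullDim R₁ = 2) : IsRegularLocalRing R₁ := by
  obtain ⟨_, x, hx, hx0, _, hT, -, hdom⟩ := id h₁
  have hx2 : x ∉ maximalIdeal R ^ 2 := IsQuadraticTransform.chart_not_mem_sq hT hdom hx0
  obtain ⟨y, hm, -, -⟩ := exists_maximalIdeal_eq_span_pair_of_not_mem_sq hdim hx hx2
  haveI := isNoetherianRing_of_isQuadraticTransform h₁ hm hx0 hT
  refine (h₁.isRegularLocalRing_of_not_forall_mem_or_inv_mem hdim hRK ?_).1
  intro hval
  have hle := ringKrullDim_le_one_of_forall_mem_or_inv_mem hval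
  rw [hd₁] at hle
  exact absurd hle (by decide)

/-- **The exceptional curve is regular at every closed point over the centre**: for a two-dimensional
quadratic transform `R₁ ⊇ R[𝔪/x]` of the two-dimensional regular local ring `R`, the chart element
`x` — a local equation of the exceptional curve `E`, `𝔪 R₁ = x R₁` — is a regular parameter of `R₁`:
`x ∉ 𝔪_{R₁}²`. [cite: Hartshorne1977, Ch. V Prop. 3.1] -/
theorem chart_not_mem_sq_maximalIdeal [IsLocalRing R₁]
    (h₁ : IsQuadraticTransform R R₁) (hdim : ringKrullDim R = 2) (hRK : IsLocalRingOf R)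
    (hd₁ : ringKrullDim R₁ = 2) {x : R} (hx : x ∈ maximalIdeal R) (hx0 : x ≠ 0)
    (hA : blowupRing R (x : K) ≤ R₁) :
    Subring.inclusion h₁.dominates.1 x ∉ maximalIdeal R₁ ^ 2 := by
  have hx2 : x ∉ maximalIdeal R ^ 2 := IsQuadraticTransform.chart_not_mem_sq hA h₁.dominates hx0
  obtain ⟨y, hm, -, -⟩ := exists_maximalIdeal_eq_span_pair_of_not_mem_sq hdim hx hx2
  obtain ⟨φ, hφ⟩ := exists_maximalIdeal_eq_span_pair_of_chart h₁ hm hx0 hA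
  haveI := isRegularLocalRing_of_isQuadraticTransform h₁ hdim hRK hd₁
  exact fst_not_mem_sq hd₁ hφ

end DimTwo

/-! ## The point of the exceptional curve through which the strict transform of a regular branch
passes -/

section Branch

variable [IsRegularLocalRing R]

omit [IsRegularLocalRing R] in
/-- For `f/x ∈ R₁` with `f, x ≠ 0`: **`f/x ∈ 𝔪_{R₁} ↔ x/f ∉ R₁`** (instance-free form of "the strict
transform of the branch `f` passes through the point `R₁`"). [folklore] -/
theorem div_mem_maximalIdeal_iff_not_mem [IsLocalRing R₁] {x f : R} (hx0 : x ≠ 0) (hf0 : f ≠ 0)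
    (hfx : ((f : R) : K) / x ∈ R₁) :
    (⟨_, hfx⟩ : R₁) ∈ maximalIdeal R₁ ↔ ((x : R) : K) / f ∉ R₁ := by
  have hx0K : ((x : R) : K) ≠ 0 := fun e => hx0 (Subtype.ext e)
  have hf0K : ((f : R) : K) ≠ 0 := fun e => hf0 (Subtype.ext e)
  rw [mem_maximalIdeal_iff_inv_not_mem]
  change ((f : R) : K) / x = 0 ∨ (((f : R) : K) / x)⁻¹ ∉ R₁ ↔ _
  rw [inv_div]
  exact ⟨fun h => h.resolve_left (div_ne_zero hf0K hx0K), Or.inr⟩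

/-- If the strict transform `f/x` of `f` is a NON-UNIT of the quadratic transform `R₁`, with
`𝔪 = (x, f)`, then `R₁` lies in the chart `R[𝔪/x]` (the other chart `R[𝔪/f]` contains `x/f`, the
inverse of `f/x`). [folklore] -/
theorem blowupRing_le_of_div_mem_maximalIdeal [IsLocalRing R₁] (h₁ : IsQuadraticTransform R R₁)
    (hdim : ringKrullDim R = 2) {x f : R} (hm : maximalIdeal R = Ideal.span {x, f})
    {hfx : ((f : R) : K) / x ∈ R₁} (hu : (⟨_, hfx⟩ : R₁) ∈ maximalIdeal R₁) :
    blowupRing R (x : K) ≤ R₁ := by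
  have hx : x ∈ maximalIdeal R := hm ▸ Ideal.subset_span (by simp)
  have hx0 : x ≠ 0 := by
    rintro rfl; exact not_mem_sq_of_span_pair hdim hm (Ideal.zero_mem _)
  have hf0 : f ≠ 0 := by
    rintro rfl; exact not_mem_sq_of_span_pair' hdim hm (Ideal.zero_mem _)
  rcases h₁.blowupRing_le_or hm with h | h
  · exact h
  · exact absurd (h (div_mem_blowupRing _ hx)) ((div_mem_maximalIdeal_iff_not_mem hx0 hf0 hfx).mp hu)

/-- **The contraction of `𝔪_{R₁}` to the chart ring `A = R[f/x]` is `(x, f/x)`** when `𝔪 = (x, f)` and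
`f/x ∈ 𝔪_{R₁}`: an element of `A` is `P(f/x)`, `P ∈ R[X]`, `≡ P(0) (mod f/x)`, and `P(0) ∈ R` is a unit
unless it lies in `𝔪 = (x, x · f/x) ⊆ (x, f/x)`. [folklore] -/
theorem comap_maximalIdeal_eq_span_pair [IsLocalRing R₁] (h₁ : IsQuadraticTransform R R₁)
    {x f : R} (hm : maximalIdeal R = Ideal.span {x, f}) (hx0 : x ≠ 0)
    (hA : chartAdjoin (K := K) x f ≤ R₁)
    (hu : Subring.inclusion hA ⟨_, Algebra.self_mem_adjoin_singleton R _⟩ ∈ maximalIdeal R₁) :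
    (maximalIdeal R₁).comap (Subring.inclusion hA) =
      Ideal.span {chartIncl x f x, ⟨_, Algebra.self_mem_adjoin_singleton R _⟩} := by
  set u : K := ((f : R) : K) / ((x : R) : K) with hudef
  set uA : chartAdjoin (K := K) x f := ⟨u, Algebra.self_mem_adjoin_singleton R _⟩ with huA
  set Q := (maximalIdeal R₁).comap (Subring.inclusion hA) with hQ
  have hx : x ∈ maximalIdeal R := hm ▸ Ideal.subset_span (by simp)
  have hxQ : chartIncl x f x ∈ Q := by
    rw [hQ, Ideal.mem_comap]
    exact (incl_mem_maximalIdeal_iff h₁.dominates x).mpr hx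
  have huQ : uA ∈ Q := by rw [hQ, Ideal.mem_comap]; exact hu
  refine le_antisymm ?_ (span_pair_le_of_mem hxQ huQ)
  intro a ha
  obtain ⟨F, hF⟩ := exists_aeval_eq_of_mem_adjoin a.2
  -- `a = u · F.divX(u) + F(0)`
  have hsplit : a = uA * ⟨aeval u F.divX, Polynomial.aeval_mem_adjoin_singleton R u⟩ +
      chartIncl x f (F.coeff 0) := Subtype.ext (by
    change (a : K) = u * aeval u F.divX + ((F.coeff 0 : R) : K)
    rw [← hF]
    conv_lhs => rw [← X_mul_divX_add F]
    rw [map_add, map_mul, aeval_X, aeval_C]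
    rfl)
  by_cases hc : F.coeff 0 ∈ maximalIdeal R
  · -- `F(0) ∈ 𝔪 = (x, f)`, and `𝔪 A = x A`
    have hcx : chartIncl x f (F.coeff 0) ∈ Ideal.span {chartIncl (K := K) x f x} := by
      rw [← map_maximalIdeal_chartIncl hm hx0]
      exact Ideal.mem_map_of_mem _ hc
    rw [hsplit]
    refine Ideal.add_mem _ (Ideal.mul_mem_right _ _ (Ideal.subset_span (by simp))) ?_
    exact Ideal.span_mono (by simp) hcx
  · -- `F(0)` is a unit: then `Q ∋ a - uA·w = F(0)` would be a unit
    exfalso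
    have hunit : IsUnit (chartIncl (K := K) x f (F.coeff 0)) :=
      ((IsLocalRing.notMem_maximalIdeal.mp hc)).map _
    have hmem : chartIncl (K := K) x f (F.coeff 0) ∈ Q := by
      have e : chartIncl (K := K) x f (F.coeff 0) =
          a - uA * ⟨aeval u F.divX, Polynomial.aeval_mem_adjoin_singleton R u⟩ := by
        rw [hsplit]; ring
      rw [e]
      exact Q.sub_mem ha (Ideal.mul_mem_right _ _ huQ)
    have hQtop : Q = ⊤ := Ideal.eq_top_of_isUnit_mem _ hmem hunit
    exact (Ideal.comap_isPrime (Subring.inclusion hA) (maximalIdeal R₁)).ne_top (hQ ▸ hQtop)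

/-- **THE POINT OF A REGULAR BRANCH: transversal to `E`, and the strict transform is regular there.**
Let `𝔪 = (x, f)` (`f` a regular branch, `x` a transversal parameter) and let `R₁` be a quadratic
transform of `R` in which the strict transform `f/x` of `f` is a non-unit. Then
`𝔪_{R₁} = (x, f/x)`: the exceptional curve `x = 0` and the strict transform `f/x = 0` are transversal
regular branches at `R₁` (both generators are regular parameters, `fst_not_mem_sq`).
[cite: Hartshorne1977, Ch. V Cor. 3.7 (r = 1)] -/
theorem maximalIdeal_eq_span_pair_of_div_mem_maximalIdeal [IsLocalRing R₁]
    (h₁ : IsQuadraticTransform R R₁) (hdim : ringKrullDim R = 2) {x f : R}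
    (hm : maximalIdeal R = Ideal.span {x, f}) {hfx : ((f : R) : K) / x ∈ R₁}
    (hu : (⟨_, hfx⟩ : R₁) ∈ maximalIdeal R₁) :
    maximalIdeal R₁ = Ideal.span {Subring.inclusion h₁.dominates.1 x, ⟨_, hfx⟩} := by
  have hx : x ∈ maximalIdeal R := hm ▸ Ideal.subset_span (by simp)
  have hx0 : x ≠ 0 := by
    rintro rfl; exact not_mem_sq_of_span_pair hdim hm (Ideal.zero_mem _)
  have hAx : blowupRing R (x : K) ≤ R₁ := blowupRing_le_of_div_mem_maximalIdeal h₁ hdim hm hu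
  have hAeq : blowupRing R (x : K) = chartAdjoin x f := blowupRing_eq_adjoin hm
  have hA : chartAdjoin (K := K) x f ≤ R₁ := hAeq ▸ hAx
  have hQ := comap_maximalIdeal_eq_span_pair h₁ hm hx0 hA hu
  rw [maximalIdeal_eq_map_comap_chart h₁ hx hx0 hAeq.le hA, hQ, Ideal.map_span, Set.image_insert_eq,
    Set.image_singleton]
  rfl

end Branch

end CampaignW46

end Summit.ResolutionOfSingularities.ResolutionOfSingularities.Theorems

end
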